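import Literature.NumberTheory.GaloisRepresentations.ContinuousCohomologyBocksteinFunctorial
import Literature.NumberTheory.GaloisRepresentations.GaloisCohomology
import HarnessLib

/-!
# Naturality of `H²(G, ℤ) ≅ Hom_cont(G, ℚ/ℤ)` and inflation–restriction for `ℤ`-coefficients

Topic `NumberTheory/GaloisRepresentations`; namespace `Literature.NumberTheory.GaloisRepresentations`.
Theorems only (no definition, no named fact).  For profinite groups `G`, `G'` and a continuous
homomorphism `θ : G' → G`, the inverse Bockstein `H2IntEquivHom : H²(·, ℤ) ⥲ Hom_cont(·, ℚ/ℤ)`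
(`ContinuousCohomologyIntCoefficients.lean`) is natural:

* **`H2IntEquivHom_pullH` — `χ_{θ^* c} = χ_c ∘ θ`** (`pullH_δ₁_ZQ`, `δ₁_H2IntEquivHom`), with the
  pointwise form `H2IntEquivHom_pullH_apply`;
* `pullH_two_ZCoeff_eq_zero_iff` — `θ^* c = 0 ↔ χ_c` vanishes on `θ(G')`;
  `pullH_two_ZCoeff_injective_of_surjective` — `θ^*` is injective on `H²(·, ℤ)` for `θ` onto.

Consequently, for a closed normal subgroup `N` (with `G ⧸ N` profinite), INFLATION–RESTRICTION for the
trivial module `ℤ` holds in degree `2` by pure character theory (as it must: `H¹(N, ℤ) = 0`):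

* `inf_two_ZCoeff_injective` — `inf : H²(G/N, ℤ) ↪ H²(G, ℤ)`;
* `exists_inf_two_ZCoeff_eq_iff` — `c` is inflated `↔ χ_c|_N = 0`;
  `res_two_ZCoeff_eq_zero_iff` — `res_N c = 0 ↔ χ_c|_N = 0`;
* **`exact_inf_res_two_ZCoeff` — `0 → H²(G/N, ℤ) → H²(G, ℤ) → H²(N, ℤ)` is exact**
  (Serre, *Galois Cohomology* I §2.6 (b); Hochschild–Serre), i.e. dually
  `Hom(G/N, ℚ/ℤ) = {χ : G → ℚ/ℤ | χ|_N = 0}`.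

Honest framing: classical; nothing here bears on abc or takes a side on [IUTchIII] Cor. 3.12.

## References
* J.-P. Serre, *Galois Cohomology* (1997), I §2.4, I §2.6 (b). [SerreGaloisCohomology1997]
* J.-P. Serre, *Local Fields* (1979), XIII §1. [SerreLocalFields1979]
-/

noncomputable section

open CategoryTheory Function

universe u

namespace Literature.NumberTheory.GaloisRepresentations

open _root_.TopRep _root_.ContRepresentation _root_.ContinuousCohomology _root_.Topology

section Naturality

variable {G : Type u} [Group G] [TopologicalSpace G] [IsTopologicalGroup G] [CompactSpace G]
  [T2Space G] [TotallyDisconnectedSpace G]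
variable {G' : Type u} [Group G'] [TopologicalSpace G'] [IsTopologicalGroup G'] [CompactSpace G']
  [T2Space G'] [TotallyDisconnectedSpace G']

/-- **Naturality of the inverse Bockstein**: `H2IntEquivHom G' (θ^* c) = (H2IntEquivHom G c) ∘ θ` —
the character of the pulled-back class is the pulled-back character.
[cite: SerreGaloisCohomology1997, I §2.4] -/
theorem H2IntEquivHom_pullH (θ : G' →ₜ* G)
    (c : continuousCohomology 2 (ContinuousRep.trivial G ℤ ZCoeff.{u}).toTopRep) :
    H2IntEquivHom G' (pullH θ (ContinuousRep.trivial G ℤ ZCoeff.{u}) 2 c) =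
      contOneCocycles.pullback θ (𝟙 ((ContinuousRep.trivial G' ℤ QModZCoeff.{u}).toTopRep))
        (H2IntEquivHom G c) := by
  apply (H2IntEquivHom G').symm.injective
  rw [LinearEquiv.symm_apply_apply, H2IntEquivHom_symm_apply]
  conv_lhs => rw [← δ₁_H2IntEquivHom c]
  rw [pullH_δ₁_ZQ, pullH_oneCocycleClass]
  rfl

/-- `χ_{θ^* c}(g') = χ_c(θ g')`. [cite: SerreGaloisCohomology1997, I §2.4] -/
theorem H2IntEquivHom_pullH_apply (θ : G' →ₜ* G)
    (c : continuousCohomology 2 (ContinuousRep.trivial G ℤ ZCoeff.{u}).toTopRep) (g' : G') :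
    (H2IntEquivHom G' (pullH θ (ContinuousRep.trivial G ℤ ZCoeff.{u}) 2 c)).1 g' =
      (H2IntEquivHom G c).1 (θ g') := by
  rw [H2IntEquivHom_pullH]
  rfl

/-- **`θ^* c = 0` in `H²(G', ℤ)` iff the character `χ_c` vanishes on `θ(G')`.**
[cite: SerreGaloisCohomology1997, I §2.4] -/
theorem pullH_two_ZCoeff_eq_zero_iff (θ : G' →ₜ* G)
    (c : continuousCohomology 2 (ContinuousRep.trivial G ℤ ZCoeff.{u}).toTopRep) :
    pullH θ (ContinuousRep.trivial G ℤ ZCoeff.{u}) 2 c = 0 ↔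
      ∀ g' : G', (H2IntEquivHom G c).1 (θ g') = 0 := by
  constructor
  · intro h g'
    have h0 : H2IntEquivHom G' (pullH θ (ContinuousRep.trivial G ℤ ZCoeff.{u}) 2 c) = 0 := by
      rw [h]; exact LinearEquiv.map_zero _
    rw [← H2IntEquivHom_pullH_apply θ c g', h0]
    rfl
  · intro h
    apply (H2IntEquivHom G').injective
    rw [H2IntEquivHom_pullH]
    refine Eq.trans ?_ (LinearEquiv.map_zero (H2IntEquivHom G')).symm
    exact Subtype.ext (ContinuousMap.ext fun g' => h g')

/-- **`θ^* : H²(G, ℤ) → H²(G', ℤ)` is injective for `θ` surjective** (a character vanishing on all of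
`G` is zero). [cite: SerreGaloisCohomology1997, I §2.4] -/
theorem pullH_two_ZCoeff_injective_of_surjective (θ : G' →ₜ* G) (hθ : Surjective θ) :
    Injective (pullH θ (ContinuousRep.trivial G ℤ ZCoeff.{u}) 2) := by
  intro c₁ c₂ h
  apply (H2IntEquivHom G).injective
  refine Subtype.ext (ContinuousMap.ext fun g => ?_)
  obtain ⟨g', rfl⟩ := hθ g
  change (H2IntEquivHom G c₁).1 (θ g') = (H2IntEquivHom G c₂).1 (θ g')
  rw [← H2IntEquivHom_pullH_apply θ c₁ g', ← H2IntEquivHom_pullH_apply θ c₂ g', h]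

end Naturality

/-! ### Inflation–restriction for `ℤ`-coefficients in degree two -/

section InfRes

variable {G : Type u} [Group G] [TopologicalSpace G] [IsTopologicalGroup G] [CompactSpace G]
  [T2Space G] [TotallyDisconnectedSpace G]
variable (N : Subgroup G) [N.Normal] [CompactSpace (G ⧸ N)] [T2Space (G ⧸ N)]
  [TotallyDisconnectedSpace (G ⧸ N)]

/-- **`inf : H²(G/N, ℤ) → H²(G, ℤ)` is injective** (`G/N` profinite): pull-back along the surjection
`G → G/N`. [cite: SerreGaloisCohomology1997, I §2.6 (b)] -/
theorem inf_two_ZCoeff_injective :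
    Injective (pullH (ContinuousMonoidHom.quotientMk N)
      (ContinuousRep.trivial (G ⧸ N) ℤ ZCoeff.{u}) 2) :=
  pullH_two_ZCoeff_injective_of_surjective _ QuotientGroup.mk_surjective

/-- **A class of `H²(G, ℤ)` is inflated from `G/N` iff its character vanishes on `N`.**
(`⇐`: a continuous character killing `N` descends to a continuous character of `G/N`, whose class
inflates to the given one by naturality and injectivity of `H2IntEquivHom`.)
[cite: SerreGaloisCohomology1997, I §2.6 (b)] -/
theorem exists_inf_two_ZCoeff_eq_iff
    (c : continuousCohomology 2 (ContinuousRep.trivial G ℤ ZCoeff.{u}).toTopRep) :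
    (∃ c₀ : continuousCohomology 2 (ContinuousRep.trivial (G ⧸ N) ℤ ZCoeff.{u}).toTopRep,
        pullH (ContinuousMonoidHom.quotientMk N) (ContinuousRep.trivial (G ⧸ N) ℤ ZCoeff.{u}) 2 c₀ = c) ↔
      ∀ n ∈ N, (H2IntEquivHom G c).1 n = 0 := by
  constructor
  · rintro ⟨c₀, rfl⟩ n hn
    rw [H2IntEquivHom_pullH_apply, ContinuousMonoidHom.quotientMk_apply,
      (QuotientGroup.eq_one_iff n).mpr hn, contOneCocycles.apply_one]
  · intro h
    set χ := H2IntEquivHom G c with hχ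
    -- `χ` as a homomorphism, killing `N`
    let φ : G →* Multiplicative QModZCoeff.{u} :=
      { toFun := fun g => Multiplicative.ofAdd (χ.1 g)
        map_one' := by rw [contOneCocycles.apply_one]; rfl
        map_mul' := fun a b => by
          rw [contOneCocycles.apply_mul_of_trivial (fun _ _ => rfl)]; rfl }
    have hφN : N ≤ φ.ker := fun n hn => by
      rw [MonoidHom.mem_ker]
      change Multiplicative.ofAdd (χ.1 n) = 1
      rw [h n hn]; rfl
    let ψ₀ : G ⧸ N →* Multiplicative QModZCoeff.{u} := QuotientGroup.lift N φ hφN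
    have hψ₀ : Continuous ψ₀ := by
      rw [(QuotientGroup.isQuotientMap_mk N).continuous_iff]
      exact (continuous_ofAdd.comp χ.1.continuous).congr fun _ => rfl
    -- the descended continuous character of `G ⧸ N`
    let ψ : contOneCocycles (ContinuousRep.trivial (G ⧸ N) ℤ QModZCoeff.{u}).toTopRep :=
      ⟨⟨fun q => Multiplicative.toAdd (ψ₀ q), continuous_toAdd.comp hψ₀⟩, fun a b => by
        change Multiplicative.toAdd (ψ₀ (a * b)) = Multiplicative.toAdd (ψ₀ a) +
          (ContinuousRep.trivial (G ⧸ N) ℤ QModZCoeff.{u}).toTopRep.ρ a (Multiplicative.toAdd (ψ₀ b))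
        rw [map_mul, toAdd_mul]
        rfl⟩
    have hψ : ∀ g : G, ψ.1 (QuotientGroup.mk g) = χ.1 g := fun _ => rfl
    refine ⟨(H2IntEquivHom (G ⧸ N)).symm ψ, ?_⟩
    apply (H2IntEquivHom G).injective
    rw [H2IntEquivHom_pullH, LinearEquiv.apply_symm_apply]
    exact Subtype.ext (ContinuousMap.ext fun g => hψ g)

variable [CompactSpace N]

omit [N.Normal] [CompactSpace (G ⧸ N)] [T2Space (G ⧸ N)] [TotallyDisconnectedSpace (G ⧸ N)] in
/-- **`res_N c = 0` in `H²(N, ℤ)` iff the character of `c` vanishes on `N`** (`N` compact).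
[cite: SerreGaloisCohomology1997, I §2.6 (b)] -/
theorem res_two_ZCoeff_eq_zero_iff
    (c : continuousCohomology 2 (ContinuousRep.trivial G ℤ ZCoeff.{u}).toTopRep) :
    pullH (subgroupIncl N) (ContinuousRep.trivial G ℤ ZCoeff.{u}) 2 c = 0 ↔
      ∀ n ∈ N, (H2IntEquivHom G c).1 n = 0 := by
  rw [pullH_two_ZCoeff_eq_zero_iff]
  exact ⟨fun h n hn => h ⟨n, hn⟩, fun h n => h n n.2⟩

/-- **Inflation–restriction for `ℤ` in degree two: `0 → H²(G/N, ℤ) → H²(G, ℤ) → H²(N, ℤ)` is exact**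
(`G` profinite, `N` closed normal with `G/N` profinite): exactness at `H²(G, ℤ)`; injectivity of the
first map is `inf_two_ZCoeff_injective`.  Dually: `Hom(G/N, ℚ/ℤ) = {χ ∈ Hom(G, ℚ/ℤ) | χ|_N = 0}`.
[cite: SerreGaloisCohomology1997, I §2.6 (b)] -/
theorem exact_inf_res_two_ZCoeff :
    Function.Exact
      (pullH (ContinuousMonoidHom.quotientMk N) (ContinuousRep.trivial (G ⧸ N) ℤ ZCoeff.{u}) 2)
      (pullH (subgroupIncl N) (ContinuousRep.trivial G ℤ ZCoeff.{u}) 2) := by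
  intro c
  rw [res_two_ZCoeff_eq_zero_iff, ← exists_inf_two_ZCoeff_eq_iff]
  rfl

end InfRes

/-! ### Descent of characters killing a normal subgroup (degree one) -/

section CharacterDescent

variable {G : Type u} [Group G] [TopologicalSpace G]
variable {A : Type u} [AddCommGroup A] [TopologicalSpace A] [DiscreteTopology A]
variable (N : Subgroup G) [N.Normal]

/-- **A continuous character killing the normal subgroup `N` descends to `G ⧸ N`**: there is a
continuous character `ψ` of `G ⧸ N` (trivial discrete coefficients) with `ψ(ḡ) = χ(g)` — the
degree-one companion of `exists_inf_two_ZCoeff_eq_iff` (inflation `Hom(G/N, A) → Hom(G, A)` is onto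
the characters trivial on `N`). [cite: SerreGaloisCohomology1997, I §2.6 (b)] -/
theorem exists_character_quotient_apply_mk_eq
    (χ : contOneCocycles (ContinuousRep.trivial G ℤ A).toTopRep) (hχ : ∀ n ∈ N, χ.1 n = 0) :
    ∃ ψ : contOneCocycles (ContinuousRep.trivial (G ⧸ N) ℤ A).toTopRep,
      ∀ g : G, ψ.1 (QuotientGroup.mk g) = χ.1 g := by
  let φ : G →* Multiplicative A :=
    { toFun := fun g => Multiplicative.ofAdd (χ.1 g)
      map_one' := by rw [contOneCocycles.apply_one]; rfl
      map_mul' := fun a b => by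
        rw [contOneCocycles.apply_mul_of_trivial (fun _ _ => rfl)]; rfl }
  have hφN : N ≤ φ.ker := fun n hn => by
    rw [MonoidHom.mem_ker]
    change Multiplicative.ofAdd (χ.1 n) = 1
    rw [hχ n hn]; rfl
  let ψ₀ : G ⧸ N →* Multiplicative A := QuotientGroup.lift N φ hφN
  have hψ₀ : Continuous ψ₀ := by
    rw [(QuotientGroup.isQuotientMap_mk N).continuous_iff]
    exact (continuous_ofAdd.comp χ.1.continuous).congr fun _ => rfl
  exact ⟨⟨⟨fun q => Multiplicative.toAdd (ψ₀ q), continuous_toAdd.comp hψ₀⟩, fun a b => by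
      change Multiplicative.toAdd (ψ₀ (a * b)) = Multiplicative.toAdd (ψ₀ a) +
        (ContinuousRep.trivial (G ⧸ N) ℤ A).toTopRep.ρ a (Multiplicative.toAdd (ψ₀ b))
      rw [map_mul, toAdd_mul]
      rfl⟩, fun _ => rfl⟩

/-- The descended character is unique. [cite: SerreGaloisCohomology1997, I §2.6 (b)] -/
theorem character_quotient_unique
    (ψ ψ' : contOneCocycles (ContinuousRep.trivial (G ⧸ N) ℤ A).toTopRep)
    (h : ∀ g : G, ψ.1 (QuotientGroup.mk g) = ψ'.1 (QuotientGroup.mk g)) : ψ = ψ' := by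
  refine Subtype.ext (ContinuousMap.ext fun q => ?_)
  obtain ⟨g, rfl⟩ := QuotientGroup.mk_surjective q
  exact h g

/-- **A continuous character of `G` is inflated from `G ⧸ N` iff it kills `N`.**
[cite: SerreGaloisCohomology1997, I §2.6 (b)] -/
theorem exists_character_pullback_quotientMk_eq_iff
    (χ : contOneCocycles (ContinuousRep.trivial G ℤ A).toTopRep) :
    (∃ ψ : contOneCocycles (ContinuousRep.trivial (G ⧸ N) ℤ A).toTopRep,
        contOneCocycles.pullback (ContinuousMonoidHom.quotientMk N)
          (𝟙 ((ContinuousRep.trivial G ℤ A).toTopRep)) ψ = χ) ↔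
      ∀ n ∈ N, χ.1 n = 0 := by
  constructor
  · rintro ⟨ψ, rfl⟩ n hn
    change ψ.1 (QuotientGroup.mk n) = 0
    rw [(QuotientGroup.eq_one_iff n).mpr hn, contOneCocycles.apply_one]
  · intro h
    obtain ⟨ψ, hψ⟩ := exists_character_quotient_apply_mk_eq N χ h
    exact ⟨ψ, Subtype.ext (ContinuousMap.ext fun g => hψ g)⟩

end CharacterDescent

end Literature.NumberTheory.GaloisRepresentations

end
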